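import Literature.AlgebraicGeometry.Frobenioids.ArchimedeanTheoremsInstances
import Literature.AlgebraicGeometry.Frobenioids.PerfectionProofs
import Literature.AlgebraicGeometry.Frobenioids.PreFrobenioidDataToFunctor
import Literature.AlgebraicGeometry.Frobenioids.FrobenioidRealificationCanonical
import Literature.AnabelianGeometry.EtaleTheta.MonoprimeStructure
import HarnessLib

/-!
# Frobenioids II, Theorem 3.6 for `C^ℚ := C^pf` and `C^ℝ := C^rlf` — the `Λ ∈ {ℚ, ℝ}` conjuncts of the
# instance statements, RESTATED over THE constructed perfection and realification (sub-DAG statements file)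

Mochizuki, *The geometry of Frobenioids II: poly-Frobenioids*, Kyushu J. Math. **62** (2008) 401–460, §3,
Example 3.3 (ii) p. 28 and Theorem 3.6 (i), (iv), (v), (vi), (viii), (ix), (x) pp. 36–38, read on the
kurims text `paper:url-4322d76898e0` [cite: MochizukiFrdII2008, Thm 3.6 pp.36-38].  Ex. 3.3 (ii), p. 28
l. 41–46: "it makes sense to speak of the perfection `C^pf` of `C` [cf. [Mzk5], Definition 3.1, (iii)]. If
`Λ` is a monoid type, then we define `C^Λ` as follows: `C^ℤ := C`; `C^ℚ := C^pf`; `C^ℝ := C^rlf` [cf. [Mzk5],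
Proposition 5.3]."

WHY THIS FILE (abc-iut cell, layer L1, sub-DAG `plan/L1/SUBDAG-FrdII-Thm36-Prop35.md`, row M13 of the
L1 lead; census of seat w4-d027, R70 (5)).  The instance statements of `ArchimedeanTheoremsInstances.lean`
(seat abc-iut-L1-t9) quantify `∀ Λ : MonoidType` over `archFrobenioid π pf rlf Λ`, where the completion data
`pf rlf : LambdaCompletion π` are a FREE INTERFACE (any category with any pre-Frobenioid structure receiving
a functor from `C`); their `Λ = ℤ` conjuncts are statements about `C` and are kernel-closed in the tree
(`thm36i_istrTypes_C'`, `thm36i_ampleTypes_C`, `thm36iv_factors_C`, `thm36v_*_C`, `thm36vi_C`, `thm36ix_C`,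
`thm36x_C`, …), but their `Λ ∈ {ℚ, ℝ}` conjuncts speak about an ARBITRARY datum and are therefore not
dischargeable as typed (findings T36vi-F1 / T36ix-F1 / T36x-F1).  Since those statements use ONLY the
fields `.str` (the structure functor) and `.cat` (the underlying category) of the completion data, this file
restates each `Λ ∈ {ℚ, ℝ}` conjunct with

* `C^ℚ := C^pf` = THE perfection of the Frobenioid `C → F_Φ` ([FrdI] Def. 3.1 (iii); the tree's
  `PreFrobenioid.Perfection hF` with its operations `PreFrobenioid.Perfection.ops hF` — seat abc-iut-L1-d9 —
  read back as a functor `C^pf → F_{Φ^pf}` through `PreFrobenioidData.toFunctor`), under the hypothesis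
  `hF : IsFrobenioid (C.toElem π)` = print's "`C` is a Frobenioid" (Ex. 3.3 (ii) p. 28 l. 38–39; the cell's
  named statement `ArchFrd.Ex33ii_isFrobenioid`, whose proof is a separate row), which the construction of
  `C^pf` takes as input;
* `C^ℝ := C^rlf` = THE realification ([FrdI] Prop. 5.3; the tree's `PreFrobenioid.rlf (C.toElem π) hΦ`, seat
  abc-iut-L1-d2, with structure functor `PreFrobenioid.rlfToElem`), where the perf-factoriality of
  `Φ = ℝ_{≥0}` that Prop. 5.3 presupposes is PROVED here (`isPerfFactorialOn_Φ`: `ℝ_{≥0}` is `ℝ`-monoprime,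
  and monoprime monoids are perf-factorial — `Literature.AnabelianGeometry.EtaleTheta.MonoprimeStructure`).

For `C^pf` the full interface datum is also constructed (`pfCompletion hF : LambdaCompletion π`, the functor
`C → C^pf` lying over `D` ON THE NOSE, `pfCompletion_over`), so that `archFrobenioid π (pfCompletion π hF) rlf .Q`
IS the perfection (`archFrobenioid_pfCompletion_Q`, `rfl`); for `C^rlf` the functor `C → C^rlf`
(= `C → C^un-tr → (C^un-tr)^pf → C^rlf`, [FrdI] Prop. 5.3) needs the model description of `C^un-tr` (Prop.
5.3 / Prop. 3.3 (iv)), not yet in the tree — it is not used by any clause below and is NOT constructed here.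

Each restated clause is ONE `def … : Prop` (nothing asserted; typed ≠ proved) whose docstring carries the
printed clause, the locator and a «SLOT» line naming the intended closer; the clauses that are VACUOUS at the
given `Λ` by the printed case distinction (e.g. "(viii) If `Λ = ℤ` …" at `Λ = ℚ`) are closed here by one-line
theorems, so that the residual open content is exactly visible.  NOT restated (recorded): (i) "model type with
rational function monoid `(Φ^fld)^Λ`" and "`(C^Λ)^un-tr ⥲ C^ℝ`" for `Λ ∈ {ℚ, ℝ}` (need the model data
`(Φ^fld)^Λ → (Φ^Λ)^gp` and the unit-trivialisation functors — t9's note in the instances file); (ii), (iii),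
(vii) and Remark 3.6.1 concern `A` / `Λ = ℤ` only.  Nothing here takes a side on [IUTchIII] Cor. 3.12.
-/

noncomputable section

namespace Literature.AlgebraicGeometry.Frobenioids

open CategoryTheory Opposite
open scoped NNReal

universe v u

namespace ArchFrd

variable {D : Type u} [Category.{v} D] (π : D ⥤ D0)

/-! ### `Φ = ℝ_{≥0}` is perf-factorial (the hypothesis of [FrdI] Prop. 5.3 for `C^rlf`) -/

/-- `ℝ_{≥0}` is `ℝ`-monoprime ([FrdI] §0 p. 10: "isomorphic to `ℝ_{≥0}`" — by the identity), hence monoprime.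
[cite: MochizukiFrdI2008, §0 p.10] -/
theorem isMonoprime_nnreal : IsMonoprime (Multiplicative ℝ≥0) :=
  .ofR ⟨⟨MulEquiv.refl _⟩⟩

/-- `ℝ_{≥0}` is perf-factorial ([FrdI] Def. 2.4 (i); monoprime ⇒ perf-factorial,
`Literature.AnabelianGeometry.EtaleTheta.MonoprimeStructure.isPerfFactorial`). [cite: MochizukiFrdI2008, Def. 2.4 (i) p.47] -/
theorem isPerfFactorial_nnreal : IsPerfFactorial (Multiplicative ℝ≥0) :=
  Literature.AnabelianGeometry.EtaleTheta.MonoprimeStructure.isPerfFactorial isMonoprime_nnreal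

/-- The divisor monoid `Φ = Φ₀|_D = ℝ_{≥0}` of Example 3.3 (i) is perf-factorial at every object — the
standing hypothesis "Suppose that `Φ` is perf-factorial" of [FrdI] Prop. 5.3 under which `C^rlf` is defined
(Ex. 3.3 (ii) p. 28: "`C^ℝ := C^rlf` [cf. [Mzk5], Proposition 5.3]"). [cite: MochizukiFrdII2008, Ex 3.3 (ii) p.28] -/
theorem isPerfFactorialOn_Φ : PreFrobenioid.IsPerfFactorialOn (Φ π) := fun _ => isPerfFactorial_nnreal

namespace Thm36Sub

/-! ### The two constructed completions `C^ℚ := C^pf`, `C^ℝ := C^rlf` (Example 3.3 (ii)) -/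

/-- **`C^ℚ := C^pf`** (Ex. 3.3 (ii) p. 28), THE perfection of the Frobenioid `C → F_Φ` ([FrdI] Def. 3.1 (iii),
`PreFrobenioid.Perfection hF`), as a category. [cite: MochizukiFrdII2008, Ex 3.3 (ii) p.28] -/
abbrev pfCat (hF : PreFrobenioid.IsFrobenioid (C.toElem π)) : Type u := PreFrobenioid.Perfection hF

/-- The pre-Frobenioid structure `C^pf → F_{Φ^pf}` of THE perfection ([FrdI] Prop. 3.2 (i): the operations
`PreFrobenioid.Perfection.ops hF`, read back as a functor by `PreFrobenioidData.toFunctor`).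
[cite: MochizukiFrdII2008, Ex 3.3 (ii) p.28] -/
abbrev pfStr (hF : PreFrobenioid.IsFrobenioid (C.toElem π)) :
    pfCat π hF ⥤ ElemFrobenioid (PreFrobenioid.Perfection.ops hF).monFunctor :=
  (PreFrobenioid.Perfection.ops hF).toFunctor

/-- **`C^ℝ := C^rlf`** (Ex. 3.3 (ii) p. 28: "[cf. [Mzk5], Proposition 5.3]"), THE realification of `C → F_Φ`
(`PreFrobenioid.rlf`, the model Frobenioid of `(Φ^rlf, ℝ · Φ^birat)`), with `Φ` perf-factorial by
`isPerfFactorialOn_Φ`. [cite: MochizukiFrdII2008, Ex 3.3 (ii) p.28] -/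
abbrev rlfCat : Type u := PreFrobenioid.rlf (C.toElem π) (isPerfFactorialOn_Φ π)

/-- The pre-Frobenioid structure `C^rlf → F_{Φ^rlf}` of THE realification (`PreFrobenioid.rlfToElem`).
[cite: MochizukiFrdII2008, Ex 3.3 (ii) p.28] -/
abbrev rlfStr :
    rlfCat π ⥤ ElemFrobenioid
      (Literature.AnabelianGeometry.EtaleTheta.rlfFunctor (Φ π)
        (PreFrobenioid.IsPerfFactorialOn.op (isPerfFactorialOn_Φ π))) :=
  PreFrobenioid.rlfToElem (C.toElem π) (isPerfFactorialOn_Φ π)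

/-! ### `C^pf` as a completion datum: the functor `C → C^pf` lies over `D` on the nose -/

/-- The square `C → C^pf → D` = `C → D` commutes ON THE NOSE (objects: `Base(A, 1) = Base(A)` definitionally;
arrows: `PreFrobenioid.Perfection.baseMap_toPf`, [FrdI] Prop. 3.2 (i)). [cite: MochizukiFrdI2008, Prop. 3.2 (i) p.58] -/
theorem toPf_comp_baseFunctor (hF : PreFrobenioid.IsFrobenioid (C.toElem π)) :
    PreFrobenioid.Perfection.toPf hF ⋙ PreFrobenioid.baseFunctor (pfStr π hF) = C.toBase π := by
  refine CategoryTheory.Functor.hext (fun _ => rfl) fun A B φ => ?_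
  change HEq (PreFrobenioid.Perfection.Hom.baseMap ((PreFrobenioid.Perfection.toPf hF).map φ))
    (PreFrobenioid.Base (C.toElem π) φ)
  exact heq_of_eq (PreFrobenioid.Perfection.baseMap_toPf (hF := hF) φ)

/-- **`C^ℚ := C^pf` as a completion datum** of the interface `LambdaCompletion π` of
`AngularFrobenioidsRelative.lean`: THE perfection, its structure functor, the functor `C → C^pf` of [FrdI]
Def. 3.1 (iii) and the on-the-nose compatibility over `D`. [cite: MochizukiFrdII2008, Ex 3.3 (ii) p.28] -/
def pfCompletion (hF : PreFrobenioid.IsFrobenioid (C.toElem π)) : LambdaCompletion π where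
  cat := pfCat π hF
  monoid := (PreFrobenioid.Perfection.ops hF).monFunctor
  str := pfStr π hF
  fromC := PreFrobenioid.Perfection.toPf hF
  over := toPf_comp_baseFunctor π hF

/-- With `pf := pfCompletion hF`, the `Λ = ℚ` member of t9's family `archFrobenioid π pf rlf` IS the perfection
(definitionally). [cite: MochizukiFrdII2008, Ex 3.3 (ii) p.28] -/
@[simp] theorem archFrobenioid_pfCompletion_Q (hF : PreFrobenioid.IsFrobenioid (C.toElem π))
    (rlf : LambdaCompletion π) : archFrobenioid π (pfCompletion π hF) rlf .Q = pfCompletion π hF := rfl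

/-! ### Theorem 3.6 (i) for `C^ℚ`, `C^ℝ` -/

/-- **Thm. 3.6 (i)** for `C^ℚ = C^pf` (p. 36): "The Frobenioid `(C^Λ)^istr` is of isotropic, base-trivial […]
type", `Λ = ℚ`, over THE perfection (sub-DAG T36-L02, `ℚ`-part). SLOT: prove from the construction of `C^pf`
(objects `(A, n)`, [FrdI] Def. 3.1 (iii)) and `thm36i_istrTypes_C'`. [cite: MochizukiFrdII2008, Thm 3.6 (i) p.36] -/
def istrTypes_Q (hF : PreFrobenioid.IsFrobenioid (C.toElem π)) : Prop := Thm36i_istrTypes (pfStr π hF)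

/-- **Thm. 3.6 (i)** for `C^ℝ = C^rlf` (p. 36): "`(C^Λ)^istr` is of isotropic, base-trivial type", `Λ = ℝ`,
over THE realification (T36-L02, `ℝ`-part). SLOT: model-Frobenioid computation in `PreFrobenioid.rlf`.
[cite: MochizukiFrdII2008, Thm 3.6 (i) p.36] -/
def istrTypes_R : Prop := Thm36i_istrTypes (rlfStr π)

/-- **Thm. 3.6 (i)** for `C^ℚ` (p. 36 l. −5): "If `Λ ≥ ℚ`, then `(C^Λ)^istr = C^Λ`" — every object of THE
perfection is isotropic (T36-L04 «Λ ≥ ℚ ⇒ (C^Λ)^istr = C^Λ», `ℚ`-part). SLOT: isotropic type of `C^pf` is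
[FrdI] Prop. 3.2 (iii) for the perfection datum (`PerfectionIsotropic.lean`, needs `C` Frobenius-isotropic =
`Ex33ii_frobeniusIsotropic`). [cite: MochizukiFrdII2008, Thm 3.6 (i) p.36] -/
def istrAll_Q (hF : PreFrobenioid.IsFrobenioid (C.toElem π)) : Prop := Thm36i_istr_all (pfStr π hF) .Q

/-- **Thm. 3.6 (i)** for `C^ℝ` (p. 36 l. −5): "If `Λ ≥ ℚ`, then `(C^Λ)^istr = C^Λ`" — every object of THE
realification is isotropic (T36-L04, `ℝ`-part). SLOT: a model Frobenioid over the perfect monoid `Φ^rlf` is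
of isotropic type. [cite: MochizukiFrdII2008, Thm 3.6 (i) p.36] -/
def istrAll_R : Prop := Thm36i_istr_all (rlfStr π) .R

/-- **Thm. 3.6 (i)** for `C^ℚ` (p. 36 l. −4 – −3): "the Frobenioid `C^Λ` is of `Aut`-ample, `Aut^sub`-ample,
`End`-ample, and metrically trivial type, but not of group-like type", `Λ = ℚ`, over THE perfection (T36-L02).
SLOT: transport of `thm36i_ampleTypes_C` along `C → C^pf` ([FrdI] Prop. 3.2 (ii)).
[cite: MochizukiFrdII2008, Thm 3.6 (i) p.36] -/
def ampleTypes_Q (hF : PreFrobenioid.IsFrobenioid (C.toElem π)) : Prop := Thm36i_ampleTypes (pfStr π hF)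

/-- **Thm. 3.6 (i)** for `C^ℝ` (p. 36 l. −4 – −3): the same typology clauses, `Λ = ℝ`, over THE realification
(T36-L02). SLOT: model-Frobenioid computation. [cite: MochizukiFrdII2008, Thm 3.6 (i) p.36] -/
def ampleTypes_R : Prop := Thm36i_ampleTypes (rlfStr π)

/-! ### Theorem 3.6 (iv) for `C^ℚ`, `C^ℝ` -/

/-- **Thm. 3.6 (iv)**, first sentence, for `C^ℚ` (p. 37): "the natural action of `Aut_F(A)` on `O^▷(A), O^×(A)`
factors through `Aut_{D₀}(A₀)`", over THE perfection (T36-L11, `ℚ`-part). SLOT: as `thm36iv_factors_C`.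
[cite: MochizukiFrdII2008, Thm 3.6 (iv) p.37] -/
def ivFactors_Q (hF : PreFrobenioid.IsFrobenioid (C.toElem π)) : Prop :=
  Thm36iv_factors (baseRC π) (pfStr π hF)

/-- **Thm. 3.6 (iv)**, first sentence, for `C^ℝ` (p. 37), over THE realification (T36-L11, `ℝ`-part).
SLOT: as `thm36iv_factors_C`. [cite: MochizukiFrdII2008, Thm 3.6 (iv) p.37] -/
def ivFactors_R : Prop := Thm36iv_factors (baseRC π) (rlfStr π)

/-- **Thm. 3.6 (iv)**, second sentence — the two REPAIRED READINGS of the layer ruling 2026-08-25T19:26:58Z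
(the printed sentence is flag L1 #6, false as printed at `Λ = ℤ`; at `Λ = ℚ` no failure is known), for
`C^ℚ` over THE perfection: faithfulness on isotropic objects ∧ the isotropic-hull reading (`ℚ`-part of the
instance `Thm36iv_readings_CA`). SLOT: w4-d103's readings for `C` transported to `C^pf`.
[cite: MochizukiFrdII2008, Thm 3.6 (iv) p.37] -/
def ivReadings_Q (hF : PreFrobenioid.IsFrobenioid (C.toElem π)) : Prop :=
  Thm36iv_faithful_of_isIsotropic (baseRC π) (pfStr π hF) .Q ∧ Thm36iv_faithful_istr (baseRC π) (pfStr π hF) .Q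

/-- **Thm. 3.6 (iv)**, second sentence, repaired readings, for `C^ℝ` over THE realification — VACUOUS: the
printed sentence (and both readings) carry the guard "`Λ ∈ {ℤ, ℚ}`" (`Λ ≠ ℝ`), so at `Λ = ℝ` there is nothing
to prove (`ivReadings_R_holds`). [cite: MochizukiFrdII2008, Thm 3.6 (iv) p.37] -/
def ivReadings_R : Prop :=
  Thm36iv_faithful_of_isIsotropic (baseRC π) (rlfStr π) .R ∧ Thm36iv_faithful_istr (baseRC π) (rlfStr π) .R

/-- The `Λ = ℝ` readings hold vacuously (guard `Λ ≠ ℝ`). [cite: MochizukiFrdII2008, Thm 3.6 (iv) p.37] -/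
theorem ivReadings_R_holds : ivReadings_R π :=
  ⟨fun h => absurd rfl h, fun h => absurd rfl h⟩

/-! ### Theorem 3.6 (v) for `C^ℚ`, `C^ℝ` -/

/-- **Thm. 3.6 (v)** for `C^ℚ = C^pf` (p. 37), all six clauses at `Λ = ℚ` over THE perfection: "`O^×(A)` is
trivial iff … (b) `Λ = ℚ` and `A` is real …"; "nontrivial and torsion free [and in fact isomorphic to
`S¹ ⊗_ℤ ℚ`] iff `Λ = ℚ` and `A` is complex"; "of order two iff `Λ = ℤ` and `A` is real" [so never, at
`Λ = ℚ`]; "infinitely many torsion elements [≅ `S¹`] iff `Λ = ℤ` and `A` complex isotropic" [so never]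
(T36-L12 `ℚ`-part; `ℚ`-conjunct of the instance `Thm36v_C`). SLOT: units of `(A, n) ∈ C^pf` = `n`-th-root
classes of units of Frobenius powers of `A`, from `thm36v_*_C` + [FrdI] Prop. 3.2 (ii).
[cite: MochizukiFrdII2008, Thm 3.6 (v) p.37] -/
def v_Q (hF : PreFrobenioid.IsFrobenioid (C.toElem π)) : Prop :=
  Thm36v_trivial (baseRC π) (pfStr π hF) .Q ∧ Thm36v_torsionFree (baseRC π) (pfStr π hF) .Q ∧
    Thm36v_isoCircleTensorRat (baseRC π) (pfStr π hF) .Q ∧ Thm36v_orderTwo (baseRC π) (pfStr π hF) .Q ∧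
    Thm36v_torsion (baseRC π) (pfStr π hF) .Q ∧ Thm36v_isoCircle (baseRC π) (pfStr π hF) .Q

/-- **Thm. 3.6 (v)** for `C^ℝ = C^rlf` (p. 37), all six clauses at `Λ = ℝ` over THE realification: "(c)
`Λ = ℝ`" — every `O^×(A)` is trivial, hence not "nontrivial torsion-free", not of order two, without
infinitely many torsion elements (T36-L12 `ℝ`-part; `ℝ`-conjunct of `Thm36v_C`). SLOT: base-identity
automorphisms of a model Frobenioid of `(Φ^rlf, ℝ · Φ^birat)` with `Φ^rlf` sharp are trivial.
[cite: MochizukiFrdII2008, Thm 3.6 (v) p.37] -/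
def v_R : Prop :=
  Thm36v_trivial (baseRC π) (rlfStr π) .R ∧ Thm36v_torsionFree (baseRC π) (rlfStr π) .R ∧
    Thm36v_isoCircleTensorRat (baseRC π) (rlfStr π) .R ∧ Thm36v_orderTwo (baseRC π) (rlfStr π) .R ∧
    Thm36v_torsion (baseRC π) (rlfStr π) .R ∧ Thm36v_isoCircle (baseRC π) (rlfStr π) .R

/-! ### Theorem 3.6 (vi) for `C^ℚ`, `C^ℝ` -/

/-- **Thm. 3.6 (vi)** for `C^ℚ = C^pf` (p. 37): "If `D` admits a pseudo-terminal object, then `F` admits a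
pseudo-terminal object" (T36-L13 `ℚ`-part; `ℚ`-conjunct of the instance `Thm36vi_CA`). SLOT: `(A, 1)` for a
pseudo-terminal `A ∈ C` (`thm36vi_C`) — every `(B, m)` maps to `(A^{(m)}, m) ≅ …`; or directly via roots.
[cite: MochizukiFrdII2008, Thm 3.6 (vi) p.37] -/
def vi_Q (hF : PreFrobenioid.IsFrobenioid (C.toElem π)) : Prop := Thm36vi D (pfCat π hF)

/-- **Thm. 3.6 (vi)** for `C^ℝ = C^rlf` (p. 37) (T36-L13 `ℝ`-part; `ℝ`-conjunct of `Thm36vi_CA`). SLOT: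
pseudo-terminal objects of a model Frobenioid over a base with a pseudo-terminal object
(`ModelFrobenioid.exists_isPseudoTerminal_of_cofinal`-type argument). [cite: MochizukiFrdII2008, Thm 3.6 (vi) p.37] -/
def vi_R : Prop := Thm36vi D (rlfCat π)

/-! ### Theorem 3.6 (viii)–(x) for `C^ℚ`, `C^ℝ` -/

/-- **Thm. 3.6 (viii)** for `C^ℚ` (p. 38): "If `Λ = ℤ`, then `F[ℂ]` is of weakly dissectible type" — VACUOUS at
`Λ = ℚ` (`viii_Q_holds`). [cite: MochizukiFrdII2008, Thm 3.6 (viii) p.38] -/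
def viii_Q (hF : PreFrobenioid.IsFrobenioid (C.toElem π)) : Prop := Thm36viii (baseRC π) (pfStr π hF) .Q

/-- **Thm. 3.6 (viii)** for `C^ℝ` (p. 38) — VACUOUS at `Λ = ℝ` (`viii_R_holds`). [cite: MochizukiFrdII2008, Thm 3.6 (viii) p.38] -/
def viii_R : Prop := Thm36viii (baseRC π) (rlfStr π) .R

/-- (viii) at `Λ = ℚ` holds vacuously. [cite: MochizukiFrdII2008, Thm 3.6 (viii) p.38] -/
theorem viii_Q_holds (hF : PreFrobenioid.IsFrobenioid (C.toElem π)) : viii_Q π hF :=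
  fun h => absurd h (by decide)

/-- (viii) at `Λ = ℝ` holds vacuously. [cite: MochizukiFrdII2008, Thm 3.6 (viii) p.38] -/
theorem viii_R_holds : viii_R π := fun h => absurd h (by decide)

/-- **Thm. 3.6 (ix)** for `C^ℚ = C^pf` (p. 38): "Suppose that `D` is of strongly indissectible type. [If `D` is
not complexifiable, then we assume further that `Λ ≠ ℤ` — automatic here.] Then `F^istr` is of strongly
indissectible type", over THE perfection (T36-L17 `ℚ`-part; `ℚ`-conjunct of the instance `Thm36ix_CA`,
finding T36ix-F1). SLOT: `(C^pf)^istr = C^pf` by (i); reduce to `Indissect.thm36ix_C` along `C → C^pf`.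
[cite: MochizukiFrdII2008, Thm 3.6 (ix) p.38] -/
def ix_Q (hF : PreFrobenioid.IsFrobenioid (C.toElem π)) : Prop := Thm36ix (baseRC π) (pfStr π hF) .Q

/-- **Thm. 3.6 (ix)** for `C^ℝ = C^rlf` (p. 38), over THE realification (T36-L17 `ℝ`-part; `ℝ`-conjunct of
`Thm36ix_CA`). SLOT: strongly indissectible type of a model Frobenioid over a strongly indissectible base.
[cite: MochizukiFrdII2008, Thm 3.6 (ix) p.38] -/
def ix_R : Prop := Thm36ix (baseRC π) (rlfStr π) .R

/-- **Thm. 3.6 (x)** for `C^ℚ` (p. 38): "If `D` is slim, and `Λ ∈ {ℤ, ℝ}`, then `F` is also slim" — VACUOUS at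
`Λ = ℚ` (guard `Λ ≠ ℚ`; `x_Q_holds`). [cite: MochizukiFrdII2008, Thm 3.6 (x) p.38] -/
def x_Q (hF : PreFrobenioid.IsFrobenioid (C.toElem π)) : Prop := Thm36x .Q D (pfCat π hF)

/-- **Thm. 3.6 (x)** for `C^ℝ = C^rlf` (p. 38): "If `D` is slim, and `Λ ∈ {ℤ, ℝ}`, then `F` is also slim", over
THE realification (`ℝ`-conjunct of the instance `Thm36x_CA`, finding T36x-F1 of seats w4-d027/w4-d091).
SLOT: slimness of a model Frobenioid over a slim base with trivial base-identity automorphisms ((v)(c)).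
[cite: MochizukiFrdII2008, Thm 3.6 (x) p.38] -/
def x_R : Prop := Thm36x .R D (rlfCat π)

/-- (x) at `Λ = ℚ` holds vacuously (the printed hypothesis `Λ ∈ {ℤ, ℝ}` fails). [cite: MochizukiFrdII2008, Thm 3.6 (x) p.38] -/
theorem x_Q_holds (hF : PreFrobenioid.IsFrobenioid (C.toElem π)) : x_Q π hF :=
  fun _ h => absurd rfl h

/-! ### The instance statements of `ArchimedeanTheoremsInstances.lean` at `pf := pfCompletion hF`:
their `Λ = ℚ` conjuncts ARE the statements above (definitional bridges) -/

/-- With `pf := pfCompletion hF` the structure functor of `C^ℚ` in t9's family is `pfStr` (`rfl`).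
[cite: MochizukiFrdII2008, Ex 3.3 (ii) p.28] -/
theorem archFrobenioid_pfCompletion_Q_str (hF : PreFrobenioid.IsFrobenioid (C.toElem π)) (rlf : LambdaCompletion π) :
    (archFrobenioid π (pfCompletion π hF) rlf .Q).str = pfStr π hF := rfl

/-- The `Λ = ℚ` conjunct of the instance `Thm36ix_CA π (pfCompletion hF) rlf` is `ix_Q hF` (`Iff.rfl`) — so a
proof of `ix_Q` closes that conjunct of t9's statement for THE perfection. [cite: MochizukiFrdII2008, Thm 3.6 (ix) p.38] -/
theorem thm36ix_instance_Q_iff (hF : PreFrobenioid.IsFrobenioid (C.toElem π)) (rlf : LambdaCompletion π) :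
    Thm36ix (baseRC π) (archFrobenioid π (pfCompletion π hF) rlf .Q).str .Q ↔ ix_Q π hF := Iff.rfl

/-- The `Λ = ℚ` conjunct of the instance `Thm36vi_CA π (pfCompletion hF) rlf` is `vi_Q hF` (`Iff.rfl`).
[cite: MochizukiFrdII2008, Thm 3.6 (vi) p.37] -/
theorem thm36vi_instance_Q_iff (hF : PreFrobenioid.IsFrobenioid (C.toElem π)) (rlf : LambdaCompletion π) :
    Thm36vi D (archFrobenioid π (pfCompletion π hF) rlf .Q).cat ↔ vi_Q π hF := Iff.rfl

/-- The `Λ = ℚ` conjunct of the instance `Thm36x_CA π (pfCompletion hF) rlf` is `x_Q hF` (`Iff.rfl`), hence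
holds (`x_Q_holds`). [cite: MochizukiFrdII2008, Thm 3.6 (x) p.38] -/
theorem thm36x_instance_Q (hF : PreFrobenioid.IsFrobenioid (C.toElem π)) (rlf : LambdaCompletion π) :
    Thm36x .Q D (archFrobenioid π (pfCompletion π hF) rlf .Q).cat := x_Q_holds π hF

end Thm36Sub

end ArchFrd

end Literature.AlgebraicGeometry.Frobenioids

end
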